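import Mathlib
import HarnessLib
import Summits.Langlands.Langlands.Theses.EvenIcosahedralCMCorner
import Literature.NumberTheory.GaloisRepresentations.ArtinCharacterReciprocityProofs
import Literature.NumberTheory.GaloisRepresentations.ArtinReciprocityCharacterProofs
import Literature.NumberTheory.GaloisRepresentations.HeckeLFunctionAnalyticProofs
import Literature.NumberTheory.Automorphic.AutomorphicTwistBJ

/-!
# `EvenIcosahedralCMCorner.UntwistAutomorphy` — proof of the item (`stmt-Langlands-14079`)

**Statement** (route `EvenIcosahedralCMCorner`, support item `UntwistAutomorphy`, binder `hG` of the
route's deciding theorem `closes`): let `M` be a number field, `σ', τ : Γ_M → GL₂(ℂ)` framed Galois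
representations and `χ : Γ_M → GL₁(ℂ)` a framed character with `τ(g) = det χ(g) · σ'(g)` for every
`g` (i.e. `τ = σ' ⊗ χ` entrywise).  If `τ` is automorphic in the almost-everywhere sense — there is a
cuspidal `π` on `GL₂(𝔸_M)` such that at all but finitely many finite places `w`, `π_w` has a Satake
parameter `α_w`, `τ` is unramified at `w` and every arithmetic Frobenius at `w` has characteristic
polynomial `∏_{a ∈ α_w} (X - a)` — then so is `σ'`.
Closing theorem (by name): `untwistAutomorphy_proof`.

**Proof** (twisting plumbing; Arthur–Clozel 1989, Ch. 3, proof of Thm. 3.1, "`ζ_v = η(ϖ_v)`").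
By Artin reciprocity for characters (tree THEOREM `artinReciprocity_character_holds`, Tate,
Cassels–Fröhlich Ch. VII §5.1 (A)) there is a Hecke character `ω` of finite order with
`χ(Frob_w) = ω(ϖ_w)` at every place `w` at which `χ` is unramified; `χ` is unramified at all but
finitely many places (`FramedArtinRep.eventually_isUnramifiedAt`).  Put `π' := π ⊗ (ω⁻¹ ∘ det)`
(`CuspidalAutomorphicRepData.twist`); at all but finitely many `w` its Satake parameter is
`ω(ϖ_w)⁻¹ · α_w` (`AutomorphicRepData.eventually_hasSatakeParamAt_twist`,
`HeckeCharacter.valueAtUniformizer_inv`).  At such `w`, with moreover `τ`, `χ` unramified and the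
Frobenius matching for `τ`: (i) `σ' = χ⁻¹ τ` kills every inertia group above `w`; (ii) for an
arithmetic Frobenius `Φ` above `w`, `σ'(Φ) = c⁻¹ · τ(Φ)` with `c = det χ(Φ) = ω(ϖ_w)`, so
`charpoly σ'(Φ) = (charpoly τ(Φ)).scaleRoots c⁻¹ = ∏_{a ∈ α_w} (X - c⁻¹ a)` — the Satake polynomial
of `π'_w`.  No conjecture or named fact is used as a hypothesis; no definition is introduced.
Ref: J. Arthur, L. Clozel, *Simple algebras, base change, and the advanced theory of the trace
formula*, Annals of Math. Studies 120 (1989), Ch. 3, Thm. 3.1 and its proof (p. 172); J. Tate,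
*Global class field theory*, Ch. VII of Cassels–Fröhlich (1967), §5.1 (A), §4.2.
(decomp-langlands lens-1 «grading / quantitative ladder», g32: automorphy in the a.e.-Satake sense
is an invariant of the `GL₁`-twist orbit — grade `0` of the twist ladder.)
-/

set_option linter.dupNamespace false -- project-wide option (lakefile weak.linter.dupNamespace); `Summit.Langlands.Langlands` is the mandated namespace

noncomputable section

namespace Summit.Langlands.Langlands.Theorems.EvenIcosahedralCMCornerUntwistAutomorphy

open scoped MatrixGroups Polynomial
open Field NumberField IsDedekindDomain Polynomial Filter
open Literature.NumberTheory.GaloisRepresentations Literature.NumberTheory.Automorphic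

/-! ### Two polynomial identities -/

/-- Scaling the roots of a Satake polynomial: `(∏_{a ∈ α} (X - a)).scaleRoots s = ∏_{a ∈ α} (X - s a)`
(Mathlib `Polynomial.X_sub_C_scaleRoots`, multiplicativity of `scaleRoots` over a domain). [folklore] -/
theorem satakePolynomial_scaleRoots (α : Multiset ℂ) (s : ℂ) :
    (satakePolynomial α).scaleRoots s = satakePolynomial (α.map (s * ·)) := by
  induction α using Multiset.induction_on with
  | empty => simp [satakePolynomial]
  | cons a α ih =>
    simp only [satakePolynomial, Multiset.map_cons, Multiset.prod_cons] at ih ⊢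
    rw [Polynomial.mul_scaleRoots_of_noZeroDivisors, ih, Polynomial.X_sub_C_scaleRoots, mul_comm a s]

/-- **Characteristic polynomial of a rescaled matrix** (re-proved here to keep the import cone of the
route inside `Literature`; same statement as `IrreducibleOffSector.charpoly_smul_eq_scaleRoots`): over an
infinite field, for `c ≠ 0`, `charpoly (c • A) = (charpoly A).scaleRoots c` — both sides are
polynomials of the same values at every `c * r` (`Matrix.det_smul`, `Polynomial.scaleRoots_eval_mul`).
[folklore] -/
private theorem charpoly_smul_eq_scaleRoots' {F : Type*} [Field F] [Infinite F] {m : Type*}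
    [Fintype m] [DecidableEq m] {c : F} (hc : c ≠ 0) (A : Matrix m m F) :
    (c • A).charpoly = A.charpoly.scaleRoots c := by
  refine Polynomial.funext fun t => ?_
  obtain ⟨r, rfl⟩ : ∃ r, t = c * r := ⟨c⁻¹ * t, (mul_inv_cancel_left₀ hc t).symm⟩
  rw [Polynomial.scaleRoots_eval_mul, Matrix.charpoly_natDegree_eq_dim, Matrix.eval_charpoly,
    Matrix.eval_charpoly, ← Matrix.det_smul]
  congr 1
  ext i j
  rcases eq_or_ne i j with rfl | hij
  · simp [Matrix.scalar_apply, mul_sub]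
  · simp [Matrix.scalar_apply, hij]

/-! ### The Galois side of the twist: `σ' = χ⁻¹ ⊗ τ` at inertia and at Frobenius -/

section Galois

variable {M : Type} [Field M]

/-- If `τ = χ ⊗ σ'` entrywise and both `τ` and `χ` are unramified at `w`, then `σ'` is unramified at
`w` (every inertia group above `w` is killed). [folklore] -/
theorem isUnramifiedAt_of_entry_twist (σ' τ : FramedGaloisRep M ℂ 2) (χ : FramedGaloisRep M ℂ 1)
    (hτ : ∀ g : absoluteGaloisGroup M, ((τ g : GL (Fin 2) ℂ) : Matrix (Fin 2) (Fin 2) ℂ) =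
      ((Matrix.GeneralLinearGroup.det (χ g) : ℂˣ) : ℂ) • ((σ' g : GL (Fin 2) ℂ) : Matrix (Fin 2) (Fin 2) ℂ))
    {w : HeightOneSpectrum (𝓞 M)} (hτw : τ.IsUnramifiedAt w) (hχw : χ.IsUnramifiedAt w) :
    σ'.IsUnramifiedAt w := by
  intro 𝔓 h𝔓 g hg
  have h1 : τ g = 1 := hτw 𝔓 h𝔓 g hg
  have h2 : χ g = 1 := hχw 𝔓 h𝔓 g hg
  have h := hτ g
  rw [h1, h2, map_one, Units.val_one, Units.val_one, one_smul] at h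
  exact Units.val_eq_one.mp h.symm

/-- If `τ = χ ⊗ σ'` entrywise, `det χ(Φ) = c` and `charpoly τ(Φ) = ∏_{a ∈ α} (X - a)`, then
`charpoly σ'(Φ) = ∏_{a ∈ α} (X - c⁻¹ a)`. [folklore] -/
theorem charpoly_of_entry_twist (σ' τ : FramedGaloisRep M ℂ 2) (χ : FramedGaloisRep M ℂ 1)
    (hτ : ∀ g : absoluteGaloisGroup M, ((τ g : GL (Fin 2) ℂ) : Matrix (Fin 2) (Fin 2) ℂ) =
      ((Matrix.GeneralLinearGroup.det (χ g) : ℂˣ) : ℂ) • ((σ' g : GL (Fin 2) ℂ) : Matrix (Fin 2) (Fin 2) ℂ))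
    (Φ : absoluteGaloisGroup M) {c : ℂ} (hc : ((Matrix.GeneralLinearGroup.det (χ Φ) : ℂˣ) : ℂ) = c)
    {α : Multiset ℂ} (hΦ : FramedRep.charpoly τ Φ = satakePolynomial α) :
    FramedRep.charpoly σ' Φ = satakePolynomial (α.map (c⁻¹ * ·)) := by
  have hc0 : c ≠ 0 := by rw [← hc]; exact Units.ne_zero _
  have hσ : ((σ' Φ : GL (Fin 2) ℂ) : Matrix (Fin 2) (Fin 2) ℂ) =
      c⁻¹ • ((τ Φ : GL (Fin 2) ℂ) : Matrix (Fin 2) (Fin 2) ℂ) := by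
    rw [hτ Φ, hc, smul_smul, inv_mul_cancel₀ hc0, one_smul]
  unfold FramedRep.charpoly at hΦ ⊢
  rw [hσ, charpoly_smul_eq_scaleRoots' (inv_ne_zero hc0), hΦ, satakePolynomial_scaleRoots]

/-- For a rank-one framed representation, the determinant of `χ(Φ)` is its unique entry; so if
`χ.HasFrobCharpolyAt w (X - C c)` then `det χ(Φ) = c` at every arithmetic Frobenius `Φ` above `w`.
[folklore] -/
theorem det_eq_of_hasFrobCharpolyAt_rank_one [NumberField M] (χ : FramedGaloisRep M ℂ 1) {w : HeightOneSpectrum (𝓞 M)}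
    {c : ℂ} (h : χ.HasFrobCharpolyAt w (X - C c)) {𝔓 : Ideal (absIntegers (𝓞 M) M)}
    (h𝔓 : 𝔓 ∈ w.primesAbove) {Φ : absoluteGaloisGroup M} (hΦ : IsArithFrobAt (𝓞 M) Φ 𝔓) :
    ((Matrix.GeneralLinearGroup.det (χ Φ) : ℂˣ) : ℂ) = c := by
  have h00 := (FramedGaloisRep.hasFrobCharpolyAt_iff_of_rank_one χ w c).mp h 𝔓 h𝔓 Φ hΦ
  rw [Matrix.GeneralLinearGroup.val_det_apply, Matrix.det_fin_one, h00]

end Galois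

/-! ### The item -/

/-- **`UntwistAutomorphy`** (item `stmt-Langlands-14079` of route `EvenIcosahedralCMCorner`), proved:
if `τ = χ ⊗ σ'` entrywise and `τ` is automorphic over `M` in the almost-everywhere Satake = Frobenius
sense, then so is `σ'` — twist `π` by the inverse of the finite-order Hecke character of `χ` given by
Artin reciprocity.  Arthur–Clozel 1989, Ch. 3, proof of Thm. 3.1; Tate, Cassels–Fröhlich Ch. VII
§5.1 (A). [cite: ArthurClozelAMS120, Ch. 3, Thm. 3.1 (p. 172)]
[cite: CasselsFrohlichANT1967, Ch. VII §5.1 Main Theorem (A), §4.2 Corollary] -/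
theorem untwistAutomorphy_proof :
    Summit.Langlands.Langlands.Theses.EvenIcosahedralCMCorner.UntwistAutomorphy := by
  intro M _ _ σ' τ χ hτ hτaut
  obtain ⟨hM, π, hπ⟩ := hτaut
  classical
  -- Artin reciprocity for the character `χ`: a finite-order Hecke character `ω` with `χ(Frob_w) = ω(ϖ_w)`
  obtain ⟨ω, hfin, hω⟩ := artinReciprocity_character_holds M χ
  have hfin' : (ω⁻¹).IsFiniteOrder := IsOfFinOrder.inv hfin
  refine ⟨hM, π.twist ω⁻¹ hfin', ?_⟩
  have h2 := AutomorphicRepData.eventually_hasSatakeParamAt_twist π.1 hfin'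
  have h3 : ∀ᶠ w : HeightOneSpectrum (𝓞 M) in cofinite, χ.IsUnramifiedAt w :=
    FramedArtinRep.eventually_isUnramifiedAt χ
  filter_upwards [hπ, h2, h3] with w hw htw hχw
  obtain ⟨α, hαπ, hτw, hτF⟩ := hw
  refine ⟨α.map ((ω.valueAtUniformizer w)⁻¹ * ·), ?_, isUnramifiedAt_of_entry_twist σ' τ χ hτ hτw hχw,
    fun 𝔓 h𝔓 Φ hΦ => ?_⟩
  · -- Satake parameter of the twist `π ⊗ (ω⁻¹ ∘ det)` at `w`
    have h := htw α hαπ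
    rw [HeckeCharacter.valueAtUniformizer_inv] at h
    rw [CuspidalAutomorphicRepData.twist_val]
    exact h
  · -- Frobenius characteristic polynomial of `σ' = χ⁻¹ ⊗ τ`
    exact charpoly_of_entry_twist σ' τ χ hτ Φ
      (det_eq_of_hasFrobCharpolyAt_rank_one χ (hω w hχw).2 h𝔓 hΦ) (hτF 𝔓 h𝔓 Φ hΦ)

end Summit.Langlands.Langlands.Theorems.EvenIcosahedralCMCornerUntwistAutomorphy

end
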